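import Mathlib
import HarnessLib
import Summits.ResolutionOfSingularities.ResolutionOfSingularities.Theorems.WildQuotientsWildQuotientResolutionS1aAuxValuative

/-!
# S1a — σ-ADMISSIBLE CENTRED VALUATIONS (TWISTED D-VAL-1 on the stalk) and the research conjectures in valuative form

[OURS · L1 W4.5c · lead-1 g9, SUCCESSOR-BRIEF-v1.2 §4 item 1 second half: "STATE the research conjecture in valuative form"] — NOT statements of the
manuscript; counted 0; AI-level work, weaker than expert review. Crux stmt-ResolutionOfSingularities-17941 (`WildQuotients.CyclicQuotientFourfolds`), line
`s1a-logminvertex` v10; registered stubs unchanged (`stub_killTouchReachAux`, `stub_auxWithinReachAux`). Route-independent.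

* `stalkPull φ hfix : 𝒪_{X,ξ} →+* 𝒪_{X,ξ}` — pull-back of germs along an endomorphism `φ` of `X` FIXING `ξ` (`stalkSpecializes` then `stalkMap`);
  `stalkPull_germ` computes it on germs of sections (`φ^* f` on `φ⁻¹U`).
* `CentredVal.IsSigmaAdmissible c σ δ :≡ ∀ y, v y + δ ≤ v (σ y − y)` — plan-1's TWISTED-INVARIANT-DESIGN v1 §1 (D-VAL-1) in its boundary-free form
  (`m = 0`; the boundary-refined form `v(σy − y) ≥ v y + δ + m·v(ε)` is STRONGER and implies this one). Sanity: monotone in `δ`; the identity is admissible;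
  `δ ≥ 1` forces `σ y − y` to be a non-unit for every `y` (σ acts trivially on the residue field).
* research defs (OURS CANDIDATES, asserted nowhere; SHARPER than the attack forms of record, which they imply by forgetting admissibility):
  **`S1.KillAdmValReach p`** (K: the kill valuation of `KillValMeetReach` can be chosen centred at a `g₀`-FIXED point and σ-ADMISSIBLE with `δ ≥ 1` for
  `σ = stalkPull (M.act.aut g₀)`), `killValMeetReach_of_killAdmValReach`; **`GameFrame.GModel.AuxAdmValAt M`** / `AuxAdmValWithin n` /
  **`AuxAdmValWithinReach p`** (A likewise), `auxValAt_of_auxAdmValAt`, `auxValWithin_of_auxAdmValWithin`, `auxValWithinReach_of_auxAdmValWithinReach`.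
  What is NOT typed (informal, successor's CC-E1): that the admissible valuation is the CANONICAL one — the σ-admissible monomial valuation minimising the
  e-weighted log discrepancy over adapted frames (census: the Θ-LP optimum in every probed type); log discrepancy has no intrinsic typed home here yet.
-/

set_option linter.dupNamespace false

noncomputable section

universe u

open CategoryTheory Limits AlgebraicGeometry TopologicalSpace Topology Opposite
open Literature.AlgebraicGeometry.Resolution Literature.AlgebraicGeometry.RelativeSpec
open Summit.ResolutionOfSingularities.ResolutionOfSingularities.Theorems.WildQuotientResolution.S1
open Summit.ResolutionOfSingularities.ResolutionOfSingularities.Theorems.WildQuotientResolution.S1.NodeAtlas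
open Summit.ResolutionOfSingularities.ResolutionOfSingularities.Theorems.WildQuotientResolution.S1.Valuative

namespace Summit.ResolutionOfSingularities.ResolutionOfSingularities.Theorems.WildQuotientResolution.S1

namespace Valuative

variable {X : Scheme.{u}} {ξ : X}

/-- **Pull-back of germs along an endomorphism fixing the point**: `𝒪_{X,ξ} → 𝒪_{X,φ ξ} = 𝒪_{X,ξ}` (specialisation iso) followed by `φ^* : 𝒪_{X,φ ξ} → 𝒪_{X,ξ}`.
[OURS · L1 W4.5c] -/
def stalkPull (φ : X ⟶ X) (hfix : φ.base ξ = ξ) : X.presheaf.stalk ξ →+* X.presheaf.stalk ξ :=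
  (φ.stalkMap ξ).hom.comp (X.presheaf.stalkSpecializes (specializes_of_eq hfix)).hom

/-- `stalkPull` on germs: the germ at `ξ` of `f ∈ Γ(U)` goes to the germ at `ξ` of `φ^* f ∈ Γ(φ⁻¹ U)`. -/
theorem stalkPull_germ (φ : X ⟶ X) (hfix : φ.base ξ = ξ) {U : X.Opens} (hξ : ξ ∈ U) (f : Γ(X, U)) :
    stalkPull φ hfix ((X.presheaf.germ U ξ hξ).hom f) =
      (X.presheaf.germ (φ ⁻¹ᵁ U) ξ (show φ.base ξ ∈ U by rw [hfix]; exact hξ)).hom ((φ.app U).hom f) := by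
  have hξ' : φ.base ξ ∈ U := by rw [hfix]; exact hξ
  have key : X.presheaf.germ U ξ hξ ≫ X.presheaf.stalkSpecializes (specializes_of_eq hfix) ≫ φ.stalkMap ξ =
      φ.app U ≫ X.presheaf.germ (φ ⁻¹ᵁ U) ξ hξ' :=
    (TopCat.Presheaf.germ_stalkSpecializes_assoc X.presheaf hξ (specializes_of_eq hfix) _).trans (Scheme.Hom.germ_stalkMap φ U ξ hξ')
  have h2 := DFunLike.congr_fun (congrArg CommRingCat.Hom.hom key) f
  simp only [CommRingCat.hom_comp, RingHom.comp_apply] at h2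
  exact h2

namespace CentredVal

/-- **σ-ADMISSIBILITY** of a centred valuation (TWISTED D-VAL-1, boundary-free form): `v(σ y − y) ≥ v(y) + δ` for every `y ∈ 𝒪_{X,ξ}`. [OURS · L1 W4.5c] -/
def IsSigmaAdmissible (c : CentredVal X ξ) (σ : X.presheaf.stalk ξ →+* X.presheaf.stalk ξ) (δ : ℕ) : Prop :=
  ∀ y, c.v y + δ ≤ c.v (σ y - y)

variable (c : CentredVal X ξ)

/-- Admissibility is monotone in `δ`. -/
theorem IsSigmaAdmissible.mono {σ : X.presheaf.stalk ξ →+* X.presheaf.stalk ξ} {δ δ' : ℕ} (h : c.IsSigmaAdmissible σ δ) (hδ : δ' ≤ δ) :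
    c.IsSigmaAdmissible σ δ' :=
  fun y => (add_le_add (le_refl (c.v y)) (Nat.cast_le.2 hδ)).trans (h y)

/-- The identity is admissible with every `δ` (`v 0 = ⊤`). -/
theorem isSigmaAdmissible_id (δ : ℕ) : c.IsSigmaAdmissible (RingHom.id _) δ := fun y => by simp

/-- With `δ ≥ 1`, admissibility forces `σ y − y` to be a NON-unit for every `y` (σ is trivial on the residue field). -/
theorem IsSigmaAdmissible.not_isUnit_sub {σ : X.presheaf.stalk ξ →+* X.presheaf.stalk ξ} {δ : ℕ} (h : c.IsSigmaAdmissible σ δ) (hδ : 1 ≤ δ)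
    (y : X.presheaf.stalk ξ) : ¬ IsUnit (σ y - y) := by
  rw [← c.one_le_map_iff]
  exact ((Nat.one_le_cast.2 hδ : (1 : ℕ∞) ≤ δ).trans le_add_self).trans (h y)

end CentredVal

end Valuative

/-! ## The research conjectures in valuative form (K) -/

/-- **`KillAdmValReach p`** (OURS CANDIDATE research statement, asserted nowhere; SHARPER than `KillValMeetReach p`): at every non-terminal model AUX-reachable
from the initial model of a crux datum with every bad point killable, there are a `g₀`-FIXED point `ξ`, a valuation centred at `ξ` which is σ-ADMISSIBLE with
some `δ ≥ 1` for `σ = stalkPull (M.act.aut g₀)`, a degree `d > 0` and finitely many `G`-stable affine charts covering `closure {ξ}` on which its valuative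
filtration is a PRINCIPAL-CENTRE CHART, with `closure {ξ}` meeting `Z(M)`. (Informally the intended `v` is the CANONICAL one: the admissible monomial valuation
minimising the e-weighted log discrepancy — not typed.) [OURS · L1 W4.5c] -/
def KillAdmValReach (p : ℕ) : Prop :=
  ∀ (k : Type) [Field k] [CharP k p] [PerfectField k] (X' X₁ : Scheme.{0})
    (f : X₁ ⟶ Spec (.of k)) (q : X' ⟶ X₁) (G : Type) [Group G] [Finite G]
    (ρ : G →* Aut X'), Nat.card G = p → IsSeparated f → LocallyOfFiniteType f → QuasiCompact f →
    IsIntegral X₁ → ∀ [IsIntegral X'], Scheme.IsRegular X' → IsFinite q → Function.Surjective q.base →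
    (∃ U : X₁.Opens, Dense (U : Set X₁) ∧ Etale (q ∣_ U)) →
    ∀ (hq : ∀ g : G, (ρ g).hom ≫ q = q),
    (∀ x y : X', q.base x = q.base y → ∃ g : G, (ρ g).hom.base x = y) →
    topologicalKrullDim X₁ ≤ 4 → Function.Injective ρ →
    ∀ (g₀ : G), (∀ g : G, g ∈ Subgroup.zpowers g₀) → ∀ [IsLocallyNoetherian X']
      (h₀ : NodeAtlas p (⟨ρ, hq⟩ : ActionOver q G) g₀),
      ∀ M : GameFrame.GModel p q G ρ g₀, (GameFrame.GModel.initial hq h₀).ReachableAux M → ¬ M.Terminal → M.jInf = ⊥ →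
        ∃ (ξ : M.V) (hfix : (M.act.aut g₀).hom.base ξ = ξ) (c : CentredVal M.V ξ) (δ : ℕ), 1 ≤ δ ∧
          c.IsSigmaAdmissible (stalkPull (M.act.aut g₀).hom hfix) δ ∧
          ∃ (n : ℕ) (O : Fin n → M.act.StableAffineOpens) (d : ℕ), 0 < d ∧
            (M.badLocus ∩ closure {ξ}).Nonempty ∧ closure {ξ} ⊆ ⋃ i, ((O i).1 : Set M.V) ∧
            ∀ i, IsPrincipalCentreChart p M.act g₀ c.rees d (O i)

/-- `KillAdmValReach p ⇒ KillValMeetReach p` (forget the fixed point and the admissibility). [OURS · L1 W4.5c] -/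
theorem killValMeetReach_of_killAdmValReach {p : ℕ} (h : KillAdmValReach p) : KillValMeetReach p := by
  intro k _ _ _ X' X₁ f q G _ _ ρ hG hfs hfft hfqc hX₁ _ hreg hqfin hqs hqet hq horb hdim hinj g₀ hg₀ _ h₀ M hR hT hj
  obtain ⟨ξ, -, c, -, -, -, n, O, d, hd, hne, hcov, hprin⟩ :=
    h k X' X₁ f q G ρ hG hfs hfft hfqc hX₁ hreg hqfin hqs hqet hq horb hdim hinj g₀ hg₀ h₀ M hR hT hj
  exact ⟨ξ, c, n, O, d, hd, hne, hcov, hprin⟩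

/-- Hence `KillAdmValReach p ⇒ KillTouchReachAux p` (the registered K stub). [OURS · L1 W4.5c] -/
theorem killTouchReachAux_of_killAdmValReach {p : ℕ} (hp : p.Prime) (h : KillAdmValReach p) : KillTouchReachAux p :=
  killTouchReachAux_of_killValMeetReach hp (killValMeetReach_of_killAdmValReach h)

/-! ## The research conjectures in valuative form (A) -/

namespace AuxValuative

section Model

variable {p : ℕ} {X' X₁ : Scheme.{0}} {q : X' ⟶ X₁} {G : Type} [Group G] {ρ : G →* Aut X'} {g₀ : G}

/-- **`AuxAdmValAt M`** (OURS CANDIDATE research statement, asserted nowhere; SHARPER than `AuxValAt M`): the valuative A certificate with `ξ` FIXED by `g₀` and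
the valuation σ-ADMISSIBLE with some `δ ≥ 1`. [OURS · L1 W4.5c] -/
def _root_.Summit.ResolutionOfSingularities.ResolutionOfSingularities.Theorems.WildQuotientResolution.S1.GameFrame.GModel.AuxAdmValAt
    (M : GameFrame.GModel p q G ρ g₀) : Prop :=
  ∃ (ξ : M.V) (hfix : (M.act.aut g₀).hom.base ξ = ξ) (c : CentredVal M.V ξ) (δ : ℕ), 1 ≤ δ ∧
    c.IsSigmaAdmissible (stalkPull (M.act.aut g₀).hom hfix) δ ∧
    ∃ (n : ℕ) (O : Fin n → M.act.StableAffineOpens) (d : ℕ), 0 < d ∧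
      (∀ i, IsCentreChart p M.act g₀ c.rees d (O i)) ∧
      closure {ξ} ⊆ ⋃ i, ((O i).1 : Set M.V) ∧ ξ ∈ M.badLocus ∧
      (∃ t ∈ irreducibleComponents ↥M.nonKillable, topologicalKrullDim ↥t = M.jInf ∧ Subtype.val '' t ⊆ closure {ξ}) ∧
      ∀ (M' : GameFrame.GModel p q G ρ g₀) (π' : M'.V ⟶ M.V), IsBlowup π' (c.rees.ideal d) → M'.π = π' ≫ M.π → M'.r = π' ≫ M.r →
        (∀ g : G, (M'.act.aut g).hom ≫ π' = π' ≫ (M.act.aut g).hom) →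
        ∀ v' ∈ M'.badLocus, π'.base v' ∈ closure {ξ} → M'.KillableAt v'

/-- `AuxAdmValAt M ⇒ AuxValAt M`. [OURS · L1 W4.5c] -/
theorem auxValAt_of_auxAdmValAt (M : GameFrame.GModel p q G ρ g₀) (h : M.AuxAdmValAt) : M.AuxValAt := by
  obtain ⟨ξ, -, c, -, -, -, n, O, d, hd, hc, hcov, hξ, ht, hkill⟩ := h
  exact ⟨ξ, c, n, O, d, hd, hc, hcov, hξ, ht, hkill⟩

/-- **`AuxAdmValWithin n M`**: the bounded recursion with `AuxAdmValAt` leaves. [OURS · L1 W4.5c · CANDIDATE] -/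
def _root_.Summit.ResolutionOfSingularities.ResolutionOfSingularities.Theorems.WildQuotientResolution.S1.GameFrame.GModel.AuxAdmValWithin :
    ℕ → GameFrame.GModel p q G ρ g₀ → Prop
  | 0, M => M.AuxAdmValAt
  | n + 1, M => M.AuxAdmValAt ∨
      ∃ (𝒦 : ReesFiltration M.V) (d : ℕ), IsAuxCentre p M.act g₀ 𝒦 d (M.badLocus)ᶜ ∧
        ∀ M' : GameFrame.GModel p q G ρ g₀, M.IsMoveOf M' 𝒦 d →
          (M'.jInf < M.jInf ∨ (M'.jInf = M.jInf ∧ M'.topCount ≤ M.topCount)) ∧ GameFrame.GModel.AuxAdmValWithin n M'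

/-- `AuxAdmValWithin n ⇒ AuxValWithin n`. [OURS · L1 W4.5c] -/
theorem auxValWithin_of_auxAdmValWithin :
    ∀ (n : ℕ) (M : GameFrame.GModel p q G ρ g₀), M.AuxAdmValWithin n → M.AuxValWithin n
  | 0, M, h => auxValAt_of_auxAdmValAt M h
  | n + 1, M, h => by
      rcases h with h | ⟨𝒦, d, haux, hmv⟩
      · exact Or.inl (auxValAt_of_auxAdmValAt M h)
      · exact Or.inr ⟨𝒦, d, haux, fun M' hm => ⟨(hmv M' hm).1, auxValWithin_of_auxAdmValWithin n M' (hmv M' hm).2⟩⟩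

end Model

/-- **`AuxAdmValWithinReach p`** (OURS CANDIDATE research statement, asserted nowhere; SHARPER than `AuxValWithinReach p`): at every non-terminal model
AUX-reachable from the initial model of a crux datum with `jInf ≠ ⊥`, `∃ n, AuxAdmValWithin n M`. [OURS · L1 W4.5c] -/
def AuxAdmValWithinReach (p : ℕ) : Prop :=
  ∀ (k : Type) [Field k] [CharP k p] [PerfectField k] (X' X₁ : Scheme.{0})
    (f : X₁ ⟶ Spec (.of k)) (q : X' ⟶ X₁) (G : Type) [Group G] [Finite G]
    (ρ : G →* Aut X'), Nat.card G = p → IsSeparated f → LocallyOfFiniteType f → QuasiCompact f →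
    IsIntegral X₁ → ∀ [IsIntegral X'], Scheme.IsRegular X' → IsFinite q → Function.Surjective q.base →
    (∃ U : X₁.Opens, Dense (U : Set X₁) ∧ Etale (q ∣_ U)) →
    ∀ (hq : ∀ g : G, (ρ g).hom ≫ q = q),
    (∀ x y : X', q.base x = q.base y → ∃ g : G, (ρ g).hom.base x = y) →
    topologicalKrullDim X₁ ≤ 4 → Function.Injective ρ →
    ∀ (g₀ : G), (∀ g : G, g ∈ Subgroup.zpowers g₀) → ∀ [IsLocallyNoetherian X']
      (h₀ : NodeAtlas p (⟨ρ, hq⟩ : ActionOver q G) g₀),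
      ∀ M : GameFrame.GModel p q G ρ g₀, (GameFrame.GModel.initial hq h₀).ReachableAux M → ¬ M.Terminal →
        M.jInf ≠ ⊥ → ∃ n : ℕ, M.AuxAdmValWithin n

/-- `AuxAdmValWithinReach p ⇒ AuxValWithinReach p`. [OURS · L1 W4.5c] -/
theorem auxValWithinReach_of_auxAdmValWithinReach {p : ℕ} (h : AuxAdmValWithinReach p) : AuxValWithinReach p := by
  intro k _ _ _ X' X₁ f q G _ _ ρ hG hfs hfft hfqc hX₁ _ hreg hqfin hqs hqet hq horb hdim hinj g₀ hg₀ _ h₀ M hR hT hj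
  obtain ⟨n, hn⟩ := h k X' X₁ f q G ρ hG hfs hfft hfqc hX₁ hreg hqfin hqs hqet hq horb hdim hinj g₀ hg₀ h₀ M hR hT hj
  exact ⟨n, auxValWithin_of_auxAdmValWithin n M hn⟩

/-- Hence `AuxAdmValWithinReach p ⇒ AuxWithinReachAux p` (the registered A stub). [OURS · L1 W4.5c] -/
theorem auxWithinReachAux_of_auxAdmValWithinReach {p : ℕ} (h : AuxAdmValWithinReach p) : AuxWithinReachAux p :=
  auxWithinReachAux_of_auxValWithinReach (auxValWithinReach_of_auxAdmValWithinReach h)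

end AuxValuative

end Summit.ResolutionOfSingularities.ResolutionOfSingularities.Theorems.WildQuotientResolution.S1

end
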